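import Summits.Parity.BatemanHorn.Theorems.SelbergDelangeRigidityLSDRealSegmentTypeILocal
import HarnessLib

/-!
# Route `SelbergDelangeRigidity`, crux `LSDRealSegment` (stmt-Parity-9770), line
# `product-anatomy-subcritical`: framework of the drop-the-max reconstruction (`stub_reconstructionUnit`, Σdeg = 2)

Step (3) of the reconstruction is the BOOKKEEPING IDENTITY on the main class: write `P(n) = a · b` with `a` the
`x^ε`-smooth part and `b` the rough part (coprime to `a`, squarefree off a thin class); then
`Σ_{d ∣ P(n), d > x} g_y(d) = Σ_{e ∣ a} g_y(e) Φ_y(b; e, x)`, `Φ_y(b; e, x) = Σ_{S ⊆ primes of b, x < e ∏ S} (y − 1)^{|S|}`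
(`sum_divisors_gt_eq_twisted_phi`): the kernel is a twisted functional of the CONFIGURATION of the large primes of `b`, and
`Σ_n g_y(e) 1[e ∣ P(n)] N_B(config)` is a twisted cheap row.  This file records the functional `phiFun` (`≥ 0`,
`≤ y^{|P|}`, monotone in the twist), the rough part `roughPart` complementary to `smoothPart` (`a b = m`, coprime), proves
the identity (`reconstruction_bookkeeping`, registered: divisors of a coprime product split; divisors of a squarefree number
are the products over subsets of its prime factors; `g_y(∏ S) = (y − 1)^{|S|}`), and the Hölder transfer
`sum_tilt_le_of_holder` by which COUNT-thin classes (e.g. the square class `{n : ∃ p > x^ε, p² ∣ P(n)}`, needed for the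
squarefree reduction) are TILT-thin from `APrioriBound` at the higher tilt `y^q < 2`.
-/

open Filter Finset Polynomial
open scoped BigOperators Topology Classical

namespace Summit.Parity.BatemanHorn.Cruxes.LSDRealSegment.ProductAnatomySubcritical

open Literature.NumberTheory.Sieve
open ArithmeticFunction (cardFactors)
noncomputable section

/-- THE FUNCTIONAL `Φ_y(P; e, x) = Σ_{S ⊆ P, x < e · ∏ S} (y − 1)^{|S|}` on a finite set of (large, distinct) primes `P`
with twist `e` and level `x`: the beyond-level part of the divisor expansion over the squarefree divisors supported on `P`.
[folklore] -/
def phiFun (y : ℝ) (P : Finset ℕ) (e x : ℕ) : ℝ :=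
  ∑ S ∈ P.powerset, if x < e * ∏ p ∈ S, p then (y - 1) ^ S.card else 0

/-- `g_y(∏_{p ∈ S} p) = (y − 1)^{|S|}` for a finite set `S` of primes. [folklore] -/
theorem omegaWeight_prod_primes (y : ℝ) (S : Finset ℕ) (hS : ∀ p ∈ S, p.Prime) :
    omegaWeight y (∏ p ∈ S, p) = (y - 1) ^ S.card := by
  induction S using Finset.induction_on with
  | empty => simp [omegaWeight]
  | insert q S hq ih =>
    have hq' : q.Prime := hS q (Finset.mem_insert_self q S)
    have hS' : ∀ p ∈ S, p.Prime := fun p hp => hS p (Finset.mem_insert_of_mem hp)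
    rw [Finset.prod_insert hq, Finset.card_insert_of_notMem hq, pow_succ,
      omegaWeight_mul y hq'.ne_zero (Finset.prod_ne_zero_iff.mpr fun p hp => (hS' p hp).ne_zero), ih hS', mul_comm]
    · have h1 : omegaWeight y q = y - 1 := by
        have := omegaWeight_prime_pow y hq' 1
        rw [pow_one] at this
        rw [this, omegaCoeff_succ, pow_zero, mul_one]
      rw [h1]
    · exact Nat.Coprime.prod_right fun p hp => (Nat.coprime_primes hq' (hS' p hp)).mpr fun h => hq (h ▸ hp)

/-- Divisor sums over a coprime product split: `Σ_{d ∣ ab} F(d) = Σ_{e ∣ a} Σ_{d' ∣ b} F(e d')`. [folklore] -/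
theorem sum_divisors_mul_of_coprime {a b : ℕ} (hab : a.Coprime b) (F : ℕ → ℝ) :
    ∑ d ∈ (a * b).divisors, F d = ∑ e ∈ a.divisors, ∑ d ∈ b.divisors, F (e * d) := by
  rw [Nat.divisors_mul, Finset.mul_def, Finset.sum_image fun p hp q hq h => hab.mul_injOn_divisors hp hq h,
    Finset.sum_product]

/-- Divisors of a squarefree number are the products over the subsets of its prime factors:
`Σ_{d ∣ b} F(d) = Σ_{S ⊆ primeFactors b} F(∏ S)`. [folklore] -/
theorem sum_divisors_eq_sum_powerset_primeFactors {b : ℕ} (hb : Squarefree b) (F : ℕ → ℝ) :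
    ∑ d ∈ b.divisors, F d = ∑ S ∈ b.primeFactors.powerset, F (∏ p ∈ S, p) := by
  rw [← Nat.divisors_filter_squarefree_of_squarefree hb, Nat.sum_divisors_filter_squarefree hb.ne_zero,
    Nat.factors_eq, List.toFinset_coe, Nat.toFinset_factors]
  refine Finset.sum_congr rfl fun S _ => ?_
  rw [Finset.prod_val]
  rfl

/-- **The bookkeeping identity of the drop-the-max reconstruction**: for `a` coprime to a squarefree `b`,
`Σ_{d ∣ ab, d > x} g_y(d) = Σ_{e ∣ a} g_y(e) · Φ_y(primeFactors b; e, x)` — the beyond-level kernel of one value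
`P(n) = a b` (`a` the smooth part, `b` the rough squarefree part) is a `g_y`-twisted functional of the configuration of
the large primes. [folklore] -/
theorem sum_divisors_gt_eq_twisted_phi {a b : ℕ} (hab : a.Coprime b) (hb : Squarefree b) (y : ℝ) (x : ℕ) :
    ∑ d ∈ (a * b).divisors.filter (fun d => x < d), omegaWeight y d =
      ∑ e ∈ a.divisors, omegaWeight y e * phiFun y b.primeFactors e x := by
  rw [Finset.sum_filter, sum_divisors_mul_of_coprime hab]
  refine Finset.sum_congr rfl fun e he => ?_
  have he0 : e ≠ 0 := (Nat.pos_of_mem_divisors he).ne'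
  have hea : e ∣ a := Nat.dvd_of_mem_divisors he
  rw [phiFun, Finset.mul_sum, sum_divisors_eq_sum_powerset_primeFactors hb]
  refine Finset.sum_congr rfl fun S hS => ?_
  have hSb : S ⊆ b.primeFactors := Finset.mem_powerset.mp hS
  have hprime : ∀ p ∈ S, p.Prime := fun p hp => Nat.prime_of_mem_primeFactors (hSb hp)
  have hS0 : ∏ p ∈ S, p ≠ 0 := Finset.prod_ne_zero_iff.mpr fun p hp => (hprime p hp).ne_zero
  have hcop : e.Coprime (∏ p ∈ S, p) :=
    Nat.Coprime.prod_right fun p hp => (hab.coprime_dvd_left hea).coprime_dvd_right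
      (Nat.dvd_of_mem_primeFactors (hSb hp))
  split_ifs with h
  · rw [omegaWeight_mul y he0 hS0 hcop, omegaWeight_prod_primes y S hprime]
  · rw [mul_zero]

/-! ### Elementary properties of `Φ_y` -/

/-- `Φ_y ≥ 0` for `y ≥ 1`. [folklore] -/
theorem phiFun_nonneg {y : ℝ} (hy : 1 ≤ y) (P : Finset ℕ) (e x : ℕ) : 0 ≤ phiFun y P e x :=
  Finset.sum_nonneg fun S _ => by
    split_ifs
    · exact pow_nonneg (by linarith) _
    · exact le_rfl

/-- `Φ_y(P; e, x) ≤ Σ_{S ⊆ P} (y − 1)^{|S|} = y^{|P|}` for `y ≥ 1` (binomial theorem). [folklore] -/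
theorem phiFun_le_pow {y : ℝ} (hy : 1 ≤ y) (P : Finset ℕ) (e x : ℕ) : phiFun y P e x ≤ y ^ P.card := by
  calc phiFun y P e x ≤ ∑ S ∈ P.powerset, (y - 1) ^ S.card := by
        refine Finset.sum_le_sum fun S _ => ?_
        split_ifs
        · exact le_rfl
        · exact pow_nonneg (by linarith) _
    _ = ∑ S ∈ P.powerset, (y - 1) ^ S.card * 1 ^ (P.card - S.card) := by simp
    _ = y ^ P.card := by rw [Finset.sum_pow_mul_eq_add_pow, sub_add_cancel]

/-- Without the level constraint the functional is the full expansion: at `x = 0` and `e ≥ 1`,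
`Φ_y(P; e, 0) = y^{|P|}`. [folklore] -/
theorem phiFun_zero_level {y : ℝ} (P : Finset ℕ) (hP : ∀ p ∈ P, p.Prime) {e : ℕ} (he : 1 ≤ e) :
    phiFun y P e 0 = y ^ P.card := by
  unfold phiFun
  rw [Finset.sum_congr rfl fun S hS => if_pos (Nat.mul_pos he (Finset.prod_pos fun p hp =>
    (hP p (Finset.mem_powerset.mp hS hp)).pos))]
  calc ∑ S ∈ P.powerset, (y - 1) ^ S.card = ∑ S ∈ P.powerset, (y - 1) ^ S.card * 1 ^ (P.card - S.card) := by simp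
    _ = y ^ P.card := by rw [Finset.sum_pow_mul_eq_add_pow, sub_add_cancel]

/-- `Φ_y` is monotone in the twist: enlarging `e` only adds admissible subsets (`y ≥ 1`). [folklore] -/
theorem phiFun_mono_twist {y : ℝ} (hy : 1 ≤ y) (P : Finset ℕ) {e e' : ℕ} (h : e ≤ e') (x : ℕ) :
    phiFun y P e x ≤ phiFun y P e' x := by
  refine Finset.sum_le_sum fun S _ => ?_
  by_cases h1 : x < e * ∏ p ∈ S, p
  · rw [if_pos h1, if_pos (h1.trans_le (Nat.mul_le_mul_right _ h))]
  · rw [if_neg h1]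
    split_ifs
    · exact pow_nonneg (by linarith) _
    · exact le_rfl

/-! ### The smooth/rough factorisation `m = a · b` -/

/-- The `z`-ROUGH part of `m`: `∏_{p > z} p^{v_p(m)}` (`= 1` for `m = 0`), the complement of `smoothPart z m`. [folklore] -/
def roughPart (z : ℝ) (m : ℕ) : ℕ :=
  m.factorization.prod fun p v => if (p : ℝ) ≤ z then 1 else p ^ v

/-- `smoothPart z m · roughPart z m = m` for `m ≥ 1`. [folklore] -/
theorem smoothPart_mul_roughPart (z : ℝ) {m : ℕ} (hm : m ≠ 0) : smoothPart z m * roughPart z m = m := by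
  unfold smoothPart roughPart
  rw [← Finsupp.prod_mul]
  conv_rhs => rw [← Nat.prod_factorization_pow_eq_self hm]
  refine Finsupp.prod_congr fun p _ => ?_
  split_ifs <;> simp

/-- The smooth and rough parts are coprime. [folklore] -/
theorem coprime_smoothPart_roughPart (z : ℝ) (m : ℕ) : (smoothPart z m).Coprime (roughPart z m) := by
  unfold smoothPart roughPart Finsupp.prod
  refine Nat.Coprime.prod_left fun p hp => Nat.Coprime.prod_right fun q hq => ?_
  have hp' : p.Prime := Nat.prime_of_mem_primeFactors (by simpa using hp)
  have hq' : q.Prime := Nat.prime_of_mem_primeFactors (by simpa using hq)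
  dsimp only
  by_cases h2 : (q : ℝ) ≤ z
  · rw [if_pos h2]
    exact Nat.coprime_one_right _
  · rw [if_neg h2]
    by_cases h1 : (p : ℝ) ≤ z
    · rw [if_pos h1]
      have hpq : p ≠ q := fun h => h2 (h ▸ h1)
      exact Nat.Coprime.pow _ _ ((Nat.coprime_primes hp' hq').mpr hpq)
    · rw [if_neg h1]
      exact Nat.coprime_one_left _

/-- **The kernel of one value through its configuration**: if the `z`-rough part of `m ≥ 1` is squarefree then
`Σ_{d ∣ m, d > x} g_y(d) = Σ_{e ∣ smoothPart z m} g_y(e) Φ_y(primeFactors (roughPart z m); e, x)`. [folklore] -/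
theorem sum_divisors_gt_eq_smooth_twisted_phi (z : ℝ) {m : ℕ} (hm : m ≠ 0) (hb : Squarefree (roughPart z m))
    (y : ℝ) (x : ℕ) :
    ∑ d ∈ m.divisors.filter (fun d => x < d), omegaWeight y d =
      ∑ e ∈ (smoothPart z m).divisors, omegaWeight y e * phiFun y (roughPart z m).primeFactors e x := by
  conv_lhs => rw [← smoothPart_mul_roughPart z hm]
  exact sum_divisors_gt_eq_twisted_phi (coprime_smoothPart_roughPart z m) hb y x

/-! ### Count-thin classes are tilt-thin (Hölder against the a priori bound at a higher tilt) -/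

/-- **Hölder transfer**: if `Σ_{n ≤ x} (y^q)^{Ω_f(n)} ≤ C x (log x)^{k(y^q − 1)}` (the a priori bound AT THE TILT `y^q`,
`q > 1`, available from `APrioriBound k f (y^q)` whenever `y^q < 2`), then for every `S ⊆ [0, x]`
`Σ_{n ∈ S} y^{Ω_f(n)} ≤ |S|^{1 − 1/q} (C x (log x)^{k(y^q−1)})^{1/q}`.  With `|S| ≤ x (log x)^{−κ}` this is
`x (log x)^{k(y^q−1)/q − κ(1 − 1/q)}`, which beats `x (log x)^{k(y−1)}` for `q` close to `1` as soon as
`κ > k(1 − y(1 − log y))` — e.g. the square class `{n : ∃ p > x^ε, p² ∣ P(n)}` (`κ = 1`, `k ≤ 2`, `y < 2`). [folklore] -/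
theorem sum_tilt_le_of_holder {k : ℕ} (f : Fin k → ℤ[X]) {y q C : ℝ} (hy : 1 ≤ y) (hq : 1 < q) {x : ℕ}
    (hC : (∑ n ∈ range (x + 1), (y ^ q) ^ stat f n) ≤ C * ((x : ℝ) * Real.log x ^ ((k : ℝ) * (y ^ q - 1))))
    {S : Finset ℕ} (hS : S ⊆ range (x + 1)) :
    ∑ n ∈ S, y ^ stat f n ≤
      (#S : ℝ) ^ (1 - 1 / q) * (C * ((x : ℝ) * Real.log x ^ ((k : ℝ) * (y ^ q - 1)))) ^ (1 / q) := by
  have hy0 : 0 ≤ y := by linarith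
  have hq0 : 0 < q := by linarith
  have hH := Real.inner_le_Lp_mul_Lq_of_nonneg S (f := fun n => y ^ stat f n) (g := fun _ => (1 : ℝ))
    (Real.HolderConjugate.conjExponent hq) (fun n _ => by positivity) (fun _ _ => zero_le_one)
  simp only [mul_one, Real.one_rpow, Finset.sum_const, nsmul_eq_mul] at hH
  -- `(y^{Ω})^q = (y^q)^{Ω}`
  have hpow : ∀ n, (y ^ stat f n) ^ q = (y ^ q) ^ stat f n := fun n => by
    rw [← Real.rpow_natCast, ← Real.rpow_mul hy0, mul_comm, Real.rpow_mul hy0, Real.rpow_natCast]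
  simp only [hpow] at hH
  have hmono : (∑ n ∈ S, (y ^ q) ^ stat f n) ≤ C * ((x : ℝ) * Real.log x ^ ((k : ℝ) * (y ^ q - 1))) :=
    (Finset.sum_le_sum_of_subset_of_nonneg hS fun n _ _ => by positivity).trans hC
  have h0 : 0 ≤ ∑ n ∈ S, (y ^ q) ^ stat f n := Finset.sum_nonneg fun n _ => by positivity
  have hconj : 1 / q.conjExponent = 1 - 1 / q := by
    rw [Real.conjExponent]
    field_simp
  rw [hconj] at hH
  calc ∑ n ∈ S, y ^ stat f n
      ≤ (∑ n ∈ S, (y ^ q) ^ stat f n) ^ (1 / q) * (#S : ℝ) ^ (1 - 1 / q) := hH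
    _ ≤ (C * ((x : ℝ) * Real.log x ^ ((k : ℝ) * (y ^ q - 1)))) ^ (1 / q) * (#S : ℝ) ^ (1 - 1 / q) :=
        mul_le_mul_of_nonneg_right (Real.rpow_le_rpow h0 hmono (by positivity)) (by positivity)
    _ = _ := mul_comm _ _

/-! ### The registered helper -/

/-- **reconstruction_bookkeeping** (registered helper of `stub_reconstructionUnit`, line `product-anatomy-subcritical`):
step (3) of the drop-the-max reconstruction, the exact bookkeeping identity — for every `m ≥ 1` whose `z`-rough part is
squarefree, the beyond-level kernel of `m` is the `g_y`-twisted configuration functional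
`Σ_{d ∣ m, d > x} g_y(d) = Σ_{e ∣ smoothPart z m} g_y(e) Φ_y(primeFactors (roughPart z m); e, x)`. [folklore] -/
theorem reconstruction_bookkeeping : ∀ (z y : ℝ) (m x : ℕ), m ≠ 0 → Squarefree (roughPart z m) →
    ∑ d ∈ m.divisors.filter (fun d => x < d), omegaWeight y d =
      ∑ e ∈ (smoothPart z m).divisors, omegaWeight y e * phiFun y (roughPart z m).primeFactors e x :=
  fun z y _ x hm hb => sum_divisors_gt_eq_smooth_twisted_phi z hm hb y x

end

end Summit.Parity.BatemanHorn.Cruxes.LSDRealSegment.ProductAnatomySubcritical
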